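import Summits.QuantumFields.YangMills.Theorems.UnitScaleTiltProp7CornerFrameLegsStepZd
import Summits.QuantumFields.YangMills.Theorems.UnitScaleTiltProp7CombAccFrameMassStep
import Literature.MathematicalPhysics.QuantumFieldTheory.Balaban1983to89.T4TermwiseTorus
import Mathlib.Algebra.Order.Chebyshev
import HarnessLib

/-!
# `UnitScaleTiltProp7CornerFrameLegsStepCell` — LANE II (R-LEGS), brick (Br-5′): THE `ℓ²` ONE-STEP LEGS INEQUALITY OVER ONE PERIOD CELL —
# `E_{l+1} ≤ 4L^{2−d}·E_l + 16L^{−d}δ₁²·M_l + 4L^{1−d}W·Σ_{z,r}Σ_{b⊂Γ_r}Σ_{t<L}‖∇Y_l‖² + 16L^{−d}W(Wδ+δ₀)²·Σ_{z,r}Σ_{b⊂Γ_r+L•e_μ}‖Y_l‖²` (`W = d·L`)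
# for ★routeR-w2's derivative recursion of the comb accumulated frames (crux `MinimiserStabilityRegPr`, stmt-QuantumFields-19200, EX lane, hN06 LANE II (QB)∕(QH1) supplier (R-LEGS);
# `--supports stmt-QuantumFields-19200 --as helper`, count-neutral)

Cell `ym3-torus` (HUMAN RULING D-0037: YM₃ on T³ is ladder rung R3 — NOT d = 4, NOT infinite volume, NOT a mass gap, NOT the Clay problem), width seat `ym-ust-20520-w4` (g12), pen of the
curved row `rlegs`.  THEOREMS ONLY (0 `def`, 0 `sorry`); nothing here claims (R-LEGS-cov), (QB), (QH1), (REC), `hN06`, EX or the crux.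

THE STEP.  ✓`Prop7CornerFrameLegsStepZd.norm_legs_succ_le` bounds the coarse covariant difference `Δ_{l+1}(ẑ, μ) = D′(ẑ) − R(T(ẑ,μ))D′(ẑ + e_μ)` at one coarse label by `(Lᵈ)⁻¹·Σ_r (A_r + B_r + C_r + D_r)`.  Here the
squares are summed over the coarse period cell `z : Site P (l+1)` (labels `ẑ = (z ·).val`): Cauchy–Schwarz over the box (`Lᵈ` points) and over the `L` straight steps, the block tiling
(★routeR-w6 ✓`Prop7CombAccFrameMassStep.valLift_blockSite`∕`sum_blockLift_eq`: `L•ẑ + boxVec r = (blockSite z r)^`) and TRANSLATION INVARIANCE of period-cell sums of `N_l`-periodic functions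
(`sum_site_shift_of_isPeriodic`, over lit ✓`T4TermwiseTorus.IsPeriodic.apply_tlift`∕`tcls_add`) turn the transported old differences into `L·E_l` and the big-rectangle term into `M_l` EXACTLY; the two
SOURCE sums (tree-word `asum`s of the single-bar tower's unit covariant differences and masses) are left RAW — their re-indexing by the tree-bond multiplicity `≤ Lᵈ` is the next (combinatorial)
brick, and their analytic size (gradient energy ∕ mass of the comb linTower per level) is ★routeR's lane.

* §1 `sum_site_shift_of_isPeriodic` — `Σ_{x : Site P l} F(x̂ + v) = Σ_x F(x̂)` for `N_l`-periodic `F`; `sq_boxMean_le` — the squared box mean.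
* §2 ★★★ `legs_step_cell_le` — the title.
HONEST SCOPE.  Summation∕bookkeeping over ✓(Br-5); the curvature letters `δ₀ δ δ₁` stay DISPLAYED; the two source sums stay raw; nothing analytic is asserted.  Rung R3; nothing of the
crux ∕ the gap is claimed.

References: T. Bałaban, CMP 98 (1985) 17–51 [Balaban1985Averaging] ((9) p.18, (56)–(58) p.27, (97) p.32, (110)–(112) p.34, (160) p.42); CMP 109 (1987) 249–301 [Balaban1987RG1]
((0.1)–(0.4) pp.251–253).
-/

set_option autoImplicit false

noncomputable section

open scoped BigOperators

namespace Summit.QuantumFields.YangMills.Theorems.Prop7CornerFrameLegsStepCell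

open Finset
open Literature.MathematicalPhysics.QuantumFieldTheory.Balaban1983to89
open B7Prop1Explicit (e hol U1 mem_U1 hol_mem asum asum_nil asum_cons stepA treeWord boxVec length_treeWord l1_boxVec_le)
open B7Eq78Linearization (conjR)
open B7Prop3GeneralRotated (tsum)
open T4TermwiseTorus (IsPeriodic tcls tlift tcls_add)
open Summit.QuantumFields.YangMills.Theorems.Prop7CornerFrameLegsLetters (asum_nonneg_of_forward)
open Summit.QuantumFields.YangMills.Theorems.Prop7CornerFrameLegsStepZd (norm_legs_succ_le asum_le_length_mul asum_mono sq_asum_treeWord_boxVec_le)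
open B7Prop10InLambda (treeWord_boxVec_pos)
open Summit.QuantumFields.YangMills.Theorems.Prop7CombAccFrameMassStep (valLift_blockSite sum_blockLift_eq)


variable {P : Params} {l : ℕ}

/-! ## §1 Translation invariance of period-cell sums; the squared box mean -/

/-- **TRANSLATION INVARIANCE OF A PERIOD-CELL SUM**: for an `N_l`-periodic `F : ℤᵈ → ℝ` and any shift `v`, `Σ_{x : Site P l} F(x̂ + v) = Σ_x F(x̂)` (`x̂ + v ≡ (x + v̄)^ mod N_l`, and
`x ↦ x + v̄` permutes the torus). [cite: Balaban1987RG1, (0.1) p.251] -/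
theorem sum_site_shift_of_isPeriodic {F : (Fin P.d → ℤ) → ℝ} (hF : IsPeriodic (P.sitesPerDir l) F) (v : Fin P.d → ℤ) :
    ∑ x : Site P l, F ((fun μ => ((x μ).val : ℤ)) + v) = ∑ x : Site P l, F (fun μ => ((x μ).val : ℤ)) := by
  -- the translation of the torus by `v̄ = tcls v`
  set c : Fin P.d → ZMod (P.sitesPerDir l) := tcls (P.sitesPerDir l) v with hc
  let τ : Site P l ≃ Site P l :=
    { toFun := fun x μ => x μ + c μ
      invFun := fun x μ => x μ - c μ
      left_inv := fun x => by funext μ; simp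
      right_inv := fun x => by funext μ; simp }
  have hre : ∀ x : Site P l, F ((fun μ => ((x μ).val : ℤ)) + v) = F (fun μ => (((τ x) μ).val : ℤ)) := by
    intro x
    have h1 : F ((fun μ => ((x μ).val : ℤ)) + v) = F (tlift (tcls (P.sitesPerDir l) ((fun μ => ((x μ).val : ℤ)) + v))) :=
      (hF.apply_tlift _).symm
    rw [h1, tcls_add]
    have hx : tcls (P.sitesPerDir l) (fun μ => ((x μ).val : ℤ)) = (x : Fin P.d → ZMod (P.sitesPerDir l)) := by
      funext κ; simp [tcls]
    rw [hx]
    rfl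
  simp_rw [hre]
  exact Fintype.sum_equiv τ _ _ (fun x => rfl)

/-- The squared box mean: `((κ)⁻¹·Σ_r s_r)² ≤ κ⁻¹·Σ_r s_r²` for `κ = #box`. [folklore] -/
theorem sq_boxMean_le {ι : Type*} [Fintype ι] [Nonempty ι] (s : ι → ℝ) :
    (((Fintype.card ι : ℝ))⁻¹ * ∑ r, s r) ^ 2 ≤ ((Fintype.card ι : ℝ))⁻¹ * ∑ r, s r ^ 2 := by
  have hκ : (0 : ℝ) < Fintype.card ι := by exact_mod_cast Fintype.card_pos
  have hcs := sq_sum_le_card_mul_sum_sq (s := (Finset.univ : Finset ι)) (f := s)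
  rw [Finset.card_univ] at hcs
  rw [mul_pow, sq]
  calc ((Fintype.card ι : ℝ))⁻¹ * ((Fintype.card ι : ℝ))⁻¹ * (∑ r, s r) ^ 2
      ≤ ((Fintype.card ι : ℝ))⁻¹ * ((Fintype.card ι : ℝ))⁻¹ * ((Fintype.card ι : ℝ) * ∑ r, s r ^ 2) :=
        mul_le_mul_of_nonneg_left hcs (by positivity)
    _ = ((Fintype.card ι : ℝ))⁻¹ * ∑ r, s r ^ 2 := by field_simp

/-! ## §2 ★★★ The `ℓ²` step over one period cell -/

section Step

variable {𝔸 : Type*} [NormedRing 𝔸] [NormOneClass 𝔸] [NormedAlgebra ℂ 𝔸]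

/-- ★★★ **THE `ℓ²` ONE-STEP LEGS INEQUALITY OVER ONE PERIOD CELL, FULLY RE-INDEXED.**  Levels `l → l+1` of the torus `P` (`l + 1 ≤ m + K`); on `ℤᵈ`: a `U1`-valued, `N_l`-periodic
background `V`, next-level transporters `T` in `U1`, an `N_l`-periodic bond field `Y`, site fields `D` (`N_l`-periodic) and `D′` tied by ★routeR-w2's recursion at every label with weight
`c = (card (Fin d → Fin L))⁻¹`; curvature letters `δ₀, δ ≥ 0`, `δ₁` displayed at every coarse label.  Then for every direction `μ`, with `∇_μ X(x) := X(x) − R(V(x,μ))X(x + e_μ)` and the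
level-`l` cell sums `E := Σ_x ‖∇_μ D(x̂)‖²`, `M := Σ_x ‖D(x̂)‖²`, `G := Σ_{x,κ} ‖∇_μ Y(x̂,κ)‖²`, `N := Σ_{x,κ} ‖Y(x̂,κ)‖²`:
`Σ_{z : Site P (l+1)} ‖∇_μ D′(ẑ)‖² ≤ 4L²(Lᵈ)⁻¹·E + 16(Lᵈ)⁻¹δ₁²·M + 4L²(dL)²·G + 16(dL)²((dL)δ + δ₀)²·N` — at `d = 3`: `E_{l+1} ≤ (4∕L)·E_l + 16L⁻³δ₁²M_l + 36L⁴G_l + 144L²(3Lδ+δ₀)²N_l`.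
Proof: ✓`norm_legs_succ_le` squared (box Cauchy–Schwarz `sq_boxMean_le`, `(a+b+c+d)² ≤ 4Σ`); the old differences by CS over `t < L` + block tiling + translation invariance (`= L·E`); the
big-rectangle term by tiling + translation (`= M`); the two source `asum`s by ✓`sq_asum_treeWord_boxVec_le` (box sums, factor `(dL)²`) + tiling + translation (`L·G`, `N`).
[cite: Balaban1985Averaging, (97) p.32, (56)-(58) p.27, (110)-(112) p.34, (160) p.42; Balaban1987RG1, (0.1)-(0.4) pp.251-253] -/
theorem legs_step_cell_le (hl : l + 1 ≤ P.m + P.K) {V T : (Fin P.d → ℤ) → Fin P.d → 𝔸ˣ} (hV : ∀ x κ, V x κ ∈ U1 𝔸) (hT : ∀ x κ, T x κ ∈ U1 𝔸)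
    (hVper : IsPeriodic (P.sitesPerDir l) V)
    (Y : (Fin P.d → ℤ) → Fin P.d → 𝔸) (hYper : IsPeriodic (P.sitesPerDir l) Y)
    (D D' : (Fin P.d → ℤ) → 𝔸) (hDper : IsPeriodic (P.sitesPerDir l) D)
    (hrec : ∀ z : Fin P.d → ℤ, D' z = ((Fintype.card (Fin P.d → Fin P.L) : ℂ))⁻¹ • ∑ r : Fin P.d → Fin P.L,
      (tsum V Y ((P.L : ℤ) • z) (treeWord (boxVec P.L r)) + conjR (hol V ((P.L : ℤ) • z) (treeWord (boxVec P.L r))) (D ((P.L : ℤ) • z + boxVec P.L r))))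
    (μ : Fin P.d) {δ₀ δ δ₁ : ℝ} (hδ₀0 : 0 ≤ δ₀) (hδn : 0 ≤ δ)
    (hδ₀ : ∀ z : Site P (l + 1), ‖((hol V ((P.L : ℤ) • (fun ν => ((z ν).val : ℤ))) (List.replicate P.L (μ, true)) : 𝔸ˣ) : 𝔸)
        - (T (fun ν => ((z ν).val : ℤ)) μ : 𝔸)‖ ≤ δ₀)
    (hδ : ∀ (y : Fin P.d → ℤ) (κ : Fin P.d),
      ‖(V y κ : 𝔸) * ((hol V (y + e κ) (List.replicate P.L (μ, true)) : 𝔸ˣ) : 𝔸)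
          - ((hol V y (List.replicate P.L (μ, true)) : 𝔸ˣ) : 𝔸) * (V (y + (P.L : ℤ) • e μ) κ : 𝔸)‖ ≤ δ)
    (hδ₁ : ∀ (z : Site P (l + 1)) (r : Fin P.d → Fin P.L),
      ‖((hol V ((P.L : ℤ) • (fun ν => ((z ν).val : ℤ))) (treeWord (boxVec P.L r)) : 𝔸ˣ) : 𝔸)
            * ((hol V ((P.L : ℤ) • (fun ν => ((z ν).val : ℤ)) + boxVec P.L r) (List.replicate P.L (μ, true)) : 𝔸ˣ) : 𝔸)
          - (T (fun ν => ((z ν).val : ℤ)) μ : 𝔸) * ((hol V ((P.L : ℤ) • ((fun ν => ((z ν).val : ℤ)) + e μ)) (treeWord (boxVec P.L r)) : 𝔸ˣ) : 𝔸)‖ ≤ δ₁) :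
    ∑ z : Site P (l + 1), ‖D' (fun ν => ((z ν).val : ℤ)) - conjR (T (fun ν => ((z ν).val : ℤ)) μ) (D' ((fun ν => ((z ν).val : ℤ)) + e μ))‖ ^ 2
      ≤ 4 * ((P.L : ℝ) ^ 2 * ((P.L : ℝ) ^ P.d)⁻¹) * ∑ x : Site P l, ‖D (fun ν => ((x ν).val : ℤ)) - conjR (V (fun ν => ((x ν).val : ℤ)) μ) (D ((fun ν => ((x ν).val : ℤ)) + e μ))‖ ^ 2
        + 16 * ((P.L : ℝ) ^ P.d)⁻¹ * δ₁ ^ 2 * ∑ x : Site P l, ‖D (fun ν => ((x ν).val : ℤ))‖ ^ 2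
        + 4 * (P.L : ℝ) ^ 2 * ((P.d * P.L : ℕ) : ℝ) ^ 2
          * ∑ x : Site P l, ∑ κ : Fin P.d, ‖Y (fun ν => ((x ν).val : ℤ)) κ - conjR (V (fun ν => ((x ν).val : ℤ)) μ) (Y ((fun ν => ((x ν).val : ℤ)) + e μ) κ)‖ ^ 2
        + 16 * ((P.d * P.L : ℕ) : ℝ) ^ 2 * (((P.d * P.L : ℕ) : ℝ) * δ + δ₀) ^ 2 * ∑ x : Site P l, ∑ κ : Fin P.d, ‖Y (fun ν => ((x ν).val : ℤ)) κ‖ ^ 2 := by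
  have hLpos : 0 < P.L := P.L_pos
  have hL0 : (0 : ℝ) < (P.L : ℝ) := Nat.cast_pos.2 hLpos
  have hLd : (0 : ℝ) < (P.L : ℝ) ^ P.d := pow_pos hL0 _
  have hcard : (Fintype.card (Fin P.d → Fin P.L) : ℝ) = (P.L : ℝ) ^ P.d := by
    rw [Fintype.card_fun, Fintype.card_fin, Fintype.card_fin]; push_cast; ring
  have hcnorm : ‖((Fintype.card (Fin P.d → Fin P.L) : ℂ))⁻¹‖ = ((P.L : ℝ) ^ P.d)⁻¹ := by
    rw [norm_inv, Complex.norm_natCast, hcard]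
  have hfw : ∀ r : Fin P.d → Fin P.L, ∀ lt ∈ treeWord (boxVec P.L r), lt.2 = true := treeWord_boxVec_pos P.L
  have hlen : ∀ r : Fin P.d → Fin P.L, ((treeWord (boxVec P.L r)).length : ℝ) ≤ ((P.d * P.L : ℕ) : ℝ) := by
    intro r; rw [length_treeWord]; exact_mod_cast l1_boxVec_le P.L r
  haveI : Nonempty (Fin P.d → Fin P.L) := ⟨fun _ => ⟨0, hLpos⟩⟩
  have hcardR : ((Finset.univ : Finset (Fin P.d → Fin P.L)).card : ℝ) = (P.L : ℝ) ^ P.d := by rw [Finset.card_univ]; exact_mod_cast hcard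
  -- (0) the raw pointwise bound at every coarse site
  have hraw : ∀ z : Site P (l + 1),
      ‖D' (fun ν => ((z ν).val : ℤ)) - conjR (T (fun ν => ((z ν).val : ℤ)) μ) (D' ((fun ν => ((z ν).val : ℤ)) + e μ))‖
        ≤ ((Fintype.card (Fin P.d → Fin P.L) : ℝ))⁻¹ * ∑ r : Fin P.d → Fin P.L,
          ( asum (fun y κ => ∑ t ∈ Finset.range P.L, ‖Y (y + (t : ℤ) • e μ) κ - conjR (V (y + (t : ℤ) • e μ) μ) (Y (y + ((t : ℤ) + 1) • e μ) κ)‖)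
              ((P.L : ℤ) • (fun ν => ((z ν).val : ℤ))) (treeWord (boxVec P.L r))
            + 2 * (((treeWord (boxVec P.L r)).length : ℝ) * δ + δ₀) * asum (fun y κ => ‖Y y κ‖) ((P.L : ℤ) • (fun ν => ((z ν).val : ℤ)) + (P.L : ℤ) • e μ) (treeWord (boxVec P.L r))
            + ∑ t ∈ Finset.range P.L, ‖D ((P.L : ℤ) • (fun ν => ((z ν).val : ℤ)) + boxVec P.L r + (t : ℤ) • e μ)
                - conjR (V ((P.L : ℤ) • (fun ν => ((z ν).val : ℤ)) + boxVec P.L r + (t : ℤ) • e μ) μ) (D ((P.L : ℤ) • (fun ν => ((z ν).val : ℤ)) + boxVec P.L r + ((t : ℤ) + 1) • e μ))‖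
            + 2 * δ₁ * ‖D ((P.L : ℤ) • (fun ν => ((z ν).val : ℤ)) + (P.L : ℤ) • e μ + boxVec P.L r)‖ ) := by
    intro z
    have h := norm_legs_succ_le P.L hV hT Y D D' _ hrec μ hδ₀0 hδn (fun ν => ((z ν).val : ℤ)) (hδ₀ z) hδ (hδ₁ z)
    rwa [hcnorm, ← hcard] at h
  -- (1) square + Cauchy–Schwarz over the box, pointwise in `z`
  have hpt : ∀ z : Site P (l + 1),
      ‖D' (fun ν => ((z ν).val : ℤ)) - conjR (T (fun ν => ((z ν).val : ℤ)) μ) (D' ((fun ν => ((z ν).val : ℤ)) + e μ))‖ ^ 2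
        ≤ ((P.L : ℝ) ^ P.d)⁻¹ * ∑ r : Fin P.d → Fin P.L, 4 *
          ( asum (fun y κ => ∑ t ∈ Finset.range P.L, ‖Y (y + (t : ℤ) • e μ) κ - conjR (V (y + (t : ℤ) • e μ) μ) (Y (y + ((t : ℤ) + 1) • e μ) κ)‖)
              ((P.L : ℤ) • (fun ν => ((z ν).val : ℤ))) (treeWord (boxVec P.L r)) ^ 2
            + (2 * (((treeWord (boxVec P.L r)).length : ℝ) * δ + δ₀) * asum (fun y κ => ‖Y y κ‖) ((P.L : ℤ) • (fun ν => ((z ν).val : ℤ)) + (P.L : ℤ) • e μ) (treeWord (boxVec P.L r))) ^ 2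
            + (∑ t ∈ Finset.range P.L, ‖D ((P.L : ℤ) • (fun ν => ((z ν).val : ℤ)) + boxVec P.L r + (t : ℤ) • e μ)
                - conjR (V ((P.L : ℤ) • (fun ν => ((z ν).val : ℤ)) + boxVec P.L r + (t : ℤ) • e μ) μ) (D ((P.L : ℤ) • (fun ν => ((z ν).val : ℤ)) + boxVec P.L r + ((t : ℤ) + 1) • e μ))‖) ^ 2
            + (2 * δ₁ * ‖D ((P.L : ℤ) • (fun ν => ((z ν).val : ℤ)) + (P.L : ℤ) • e μ + boxVec P.L r)‖) ^ 2 ) := by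
    intro z
    have h := hraw z
    have hnn : 0 ≤ ‖D' (fun ν => ((z ν).val : ℤ)) - conjR (T (fun ν => ((z ν).val : ℤ)) μ) (D' ((fun ν => ((z ν).val : ℤ)) + e μ))‖ := norm_nonneg _
    refine (pow_le_pow_left₀ hnn h 2).trans ?_
    refine (sq_boxMean_le _).trans ?_
    rw [hcard, Finset.mul_sum, Finset.mul_sum]
    have h4 : ∀ a b c d : ℝ, (a + b + c + d) ^ 2 ≤ 4 * (a ^ 2 + b ^ 2 + c ^ 2 + d ^ 2) := fun a b c d => by
      nlinarith [sq_nonneg (a - b), sq_nonneg (a - c), sq_nonneg (a - d), sq_nonneg (b - c), sq_nonneg (b - d), sq_nonneg (c - d)]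
    refine Finset.sum_le_sum fun r _ => mul_le_mul_of_nonneg_left (h4 _ _ _ _) (by positivity)
  -- (2A) source gradient part through the box: `(asum gY)² ≤ (dL)²·Σ_{s,κ} gY² ≤ (dL)²·L·Σ_{s,κ} gY2`
  have hA2 : ∀ (z : Site P (l + 1)) (r : Fin P.d → Fin P.L),
      asum (fun y κ => ∑ t ∈ Finset.range P.L, ‖Y (y + (t : ℤ) • e μ) κ - conjR (V (y + (t : ℤ) • e μ) μ) (Y (y + ((t : ℤ) + 1) • e μ) κ)‖)
          ((P.L : ℤ) • (fun ν => ((z ν).val : ℤ))) (treeWord (boxVec P.L r)) ^ 2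
        ≤ ((P.d * P.L : ℕ) : ℝ) ^ 2 * ((P.L : ℝ) * ∑ s : Fin P.d → Fin P.L, ∑ κ : Fin P.d, ∑ t ∈ Finset.range P.L,
            ‖Y ((fun ν => (((Site.blockSite z s) ν).val : ℤ)) + (t : ℤ) • e μ) κ
              - conjR (V ((fun ν => (((Site.blockSite z s) ν).val : ℤ)) + (t : ℤ) • e μ) μ) (Y ((fun ν => (((Site.blockSite z s) ν).val : ℤ)) + (t : ℤ) • e μ + e μ) κ)‖ ^ 2) := by
    intro z r
    have h1 := sq_asum_treeWord_boxVec_le P.L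
      (f := fun y κ => ∑ t ∈ Finset.range P.L, ‖Y (y + (t : ℤ) • e μ) κ - conjR (V (y + (t : ℤ) • e μ) μ) (Y (y + ((t : ℤ) + 1) • e μ) κ)‖)
      (fun _ _ => Finset.sum_nonneg fun _ _ => norm_nonneg _) ((P.L : ℤ) • (fun ν => ((z ν).val : ℤ))) r
    refine h1.trans (mul_le_mul_of_nonneg_left ?_ (by positivity))
    rw [Finset.mul_sum]
    refine Finset.sum_le_sum fun s _ => ?_
    rw [Finset.mul_sum]
    refine Finset.sum_le_sum fun κ _ => ?_
    have hcs := sq_sum_le_card_mul_sum_sq (s := Finset.range P.L)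
      (f := fun t => ‖Y ((P.L : ℤ) • (fun ν => ((z ν).val : ℤ)) + boxVec P.L s + (t : ℤ) • e μ) κ
        - conjR (V ((P.L : ℤ) • (fun ν => ((z ν).val : ℤ)) + boxVec P.L s + (t : ℤ) • e μ) μ) (Y ((P.L : ℤ) • (fun ν => ((z ν).val : ℤ)) + boxVec P.L s + ((t : ℤ) + 1) • e μ) κ)‖)
    rw [Finset.card_range] at hcs
    refine hcs.trans (le_of_eq ?_)
    congr 1
    refine Finset.sum_congr rfl fun t _ => ?_
    rw [valLift_blockSite hl z s, add_smul, one_smul, ← add_assoc]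
  -- (2B) source curvature part through the box
  have hB2 : ∀ (z : Site P (l + 1)) (r : Fin P.d → Fin P.L),
      (2 * (((treeWord (boxVec P.L r)).length : ℝ) * δ + δ₀) * asum (fun y κ => ‖Y y κ‖) ((P.L : ℤ) • (fun ν => ((z ν).val : ℤ)) + (P.L : ℤ) • e μ) (treeWord (boxVec P.L r))) ^ 2
        ≤ 4 * (((P.d * P.L : ℕ) : ℝ) * δ + δ₀) ^ 2 * (((P.d * P.L : ℕ) : ℝ) ^ 2
          * ∑ s : Fin P.d → Fin P.L, ∑ κ : Fin P.d, ‖Y ((fun ν => (((Site.blockSite z s) ν).val : ℤ)) + (P.L : ℤ) • e μ) κ‖ ^ 2) := by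
    intro z r
    have h1 := sq_asum_treeWord_boxVec_le P.L (f := fun y κ => ‖Y y κ‖) (fun _ _ => norm_nonneg _) ((P.L : ℤ) • (fun ν => ((z ν).val : ℤ)) + (P.L : ℤ) • e μ) r
    have hw0 : 0 ≤ ((treeWord (boxVec P.L r)).length : ℝ) * δ + δ₀ := by positivity
    have hwW : ((treeWord (boxVec P.L r)).length : ℝ) * δ + δ₀ ≤ ((P.d * P.L : ℕ) : ℝ) * δ + δ₀ := by nlinarith [hlen r]
    have e2 : (((treeWord (boxVec P.L r)).length : ℝ) * δ + δ₀) ^ 2 ≤ (((P.d * P.L : ℕ) : ℝ) * δ + δ₀) ^ 2 := pow_le_pow_left₀ hw0 hwW 2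
    have hbox : ∀ s : Fin P.d → Fin P.L, (P.L : ℤ) • (fun ν => ((z ν).val : ℤ)) + (P.L : ℤ) • e μ + boxVec P.L s
        = (fun ν => (((Site.blockSite z s) ν).val : ℤ)) + (P.L : ℤ) • e μ := fun s => by rw [valLift_blockSite hl z s]; abel
    simp_rw [hbox] at h1
    have hS0 : 0 ≤ ∑ s : Fin P.d → Fin P.L, ∑ κ : Fin P.d, ‖Y ((fun ν => (((Site.blockSite z s) ν).val : ℤ)) + (P.L : ℤ) • e μ) κ‖ ^ 2 :=
      Finset.sum_nonneg fun _ _ => Finset.sum_nonneg fun _ _ => sq_nonneg _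
    rw [mul_pow, mul_pow]
    calc (2 : ℝ) ^ 2 * (((treeWord (boxVec P.L r)).length : ℝ) * δ + δ₀) ^ 2
          * asum (fun y κ => ‖Y y κ‖) ((P.L : ℤ) • (fun ν => ((z ν).val : ℤ)) + (P.L : ℤ) • e μ) (treeWord (boxVec P.L r)) ^ 2
        ≤ 2 ^ 2 * (((P.d * P.L : ℕ) : ℝ) * δ + δ₀) ^ 2 * (((P.d * P.L : ℕ) : ℝ) ^ 2
          * ∑ s : Fin P.d → Fin P.L, ∑ κ : Fin P.d, ‖Y ((fun ν => (((Site.blockSite z s) ν).val : ℤ)) + (P.L : ℤ) • e μ) κ‖ ^ 2) := by gcongr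
      _ = _ := by ring
  -- (2C) old differences: CS over `t`, written on the block labels
  have hC2 : ∀ (z : Site P (l + 1)) (r : Fin P.d → Fin P.L),
      (∑ t ∈ Finset.range P.L, ‖D ((P.L : ℤ) • (fun ν => ((z ν).val : ℤ)) + boxVec P.L r + (t : ℤ) • e μ)
          - conjR (V ((P.L : ℤ) • (fun ν => ((z ν).val : ℤ)) + boxVec P.L r + (t : ℤ) • e μ) μ) (D ((P.L : ℤ) • (fun ν => ((z ν).val : ℤ)) + boxVec P.L r + ((t : ℤ) + 1) • e μ))‖) ^ 2
        ≤ (P.L : ℝ) * ∑ t ∈ Finset.range P.L, ‖D ((fun ν => (((Site.blockSite z r) ν).val : ℤ)) + (t : ℤ) • e μ)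
          - conjR (V ((fun ν => (((Site.blockSite z r) ν).val : ℤ)) + (t : ℤ) • e μ) μ) (D ((fun ν => (((Site.blockSite z r) ν).val : ℤ)) + (t : ℤ) • e μ + e μ))‖ ^ 2 := by
    intro z r
    have hcs := sq_sum_le_card_mul_sum_sq (s := Finset.range P.L) (f := fun t => ‖D ((P.L : ℤ) • (fun ν => ((z ν).val : ℤ)) + boxVec P.L r + (t : ℤ) • e μ)
          - conjR (V ((P.L : ℤ) • (fun ν => ((z ν).val : ℤ)) + boxVec P.L r + (t : ℤ) • e μ) μ) (D ((P.L : ℤ) • (fun ν => ((z ν).val : ℤ)) + boxVec P.L r + ((t : ℤ) + 1) • e μ))‖)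
    rw [Finset.card_range] at hcs
    refine hcs.trans (le_of_eq ?_)
    congr 1
    refine Finset.sum_congr rfl fun t _ => ?_
    rw [valLift_blockSite hl z r, add_smul, one_smul, ← add_assoc]
  have hD2 : ∀ (z : Site P (l + 1)) (r : Fin P.d → Fin P.L),
      (2 * δ₁ * ‖D ((P.L : ℤ) • (fun ν => ((z ν).val : ℤ)) + (P.L : ℤ) • e μ + boxVec P.L r)‖) ^ 2
        = 4 * δ₁ ^ 2 * ‖D ((fun ν => (((Site.blockSite z r) ν).val : ℤ)) + (P.L : ℤ) • e μ)‖ ^ 2 := by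
    intro z r
    rw [show (P.L : ℤ) • (fun ν => ((z ν).val : ℤ)) + (P.L : ℤ) • e μ + boxVec P.L r = (fun ν => (((Site.blockSite z r) ν).val : ℤ)) + (P.L : ℤ) • e μ by
      rw [valLift_blockSite hl z r]; abel]
    ring
  -- (3) periodic letters and the four re-indexings over the fine cell
  have hnDper : IsPeriodic (P.sitesPerDir l) (fun x => ‖D x - conjR (V x μ) (D (x + e μ))‖ ^ 2) := by
    intro x m
    have hV' : V (x + ((P.sitesPerDir l : ℕ) : ℤ) • m) = V x := hVper x m
    simp only
    rw [show x + ((P.sitesPerDir l : ℕ) : ℤ) • m + e μ = x + e μ + ((P.sitesPerDir l : ℕ) : ℤ) • m by abel, hDper, hDper, hV']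
  have hnYper : ∀ κ : Fin P.d, IsPeriodic (P.sitesPerDir l) (fun x => ‖Y x κ - conjR (V x μ) (Y (x + e μ) κ)‖ ^ 2) := by
    intro κ x m
    have hV' : V (x + ((P.sitesPerDir l : ℕ) : ℤ) • m) = V x := hVper x m
    have hY1 : Y (x + ((P.sitesPerDir l : ℕ) : ℤ) • m) = Y x := hYper x m
    have hY2 : Y (x + e μ + ((P.sitesPerDir l : ℕ) : ℤ) • m) = Y (x + e μ) := hYper (x + e μ) m
    simp only
    rw [show x + ((P.sitesPerDir l : ℕ) : ℤ) • m + e μ = x + e μ + ((P.sitesPerDir l : ℕ) : ℤ) • m by abel, hY1, hY2, hV']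
  have hDnper : IsPeriodic (P.sitesPerDir l) (fun x => ‖D x‖ ^ 2) := by
    intro x m; simp only; rw [hDper x m]
  have hYnper : ∀ κ : Fin P.d, IsPeriodic (P.sitesPerDir l) (fun x => ‖Y x κ‖ ^ 2) := by
    intro κ x m
    have hY1 : Y (x + ((P.sitesPerDir l : ℕ) : ℤ) • m) = Y x := hYper x m
    simp only; rw [hY1]
  -- a generic «tiling + shift» identity: `Σ_z Σ_s F((blockSite z s)^ + v) = Σ_x F(x̂)` for periodic `F`
  have htile : ∀ (F : (Fin P.d → ℤ) → ℝ), IsPeriodic (P.sitesPerDir l) F → ∀ v : Fin P.d → ℤ,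
      ∑ z : Site P (l + 1), ∑ s : Fin P.d → Fin P.L, F ((fun ν => (((Site.blockSite z s) ν).val : ℤ)) + v) = ∑ x : Site P l, F (fun ν => ((x ν).val : ℤ)) := by
    intro F hF v
    rw [sum_blockLift_eq hl (fun x => F (x + v))]
    exact sum_site_shift_of_isPeriodic hF v
  have hCsum : ∑ z : Site P (l + 1), ∑ r : Fin P.d → Fin P.L, ∑ t ∈ Finset.range P.L, ‖D ((fun ν => (((Site.blockSite z r) ν).val : ℤ)) + (t : ℤ) • e μ)
          - conjR (V ((fun ν => (((Site.blockSite z r) ν).val : ℤ)) + (t : ℤ) • e μ) μ) (D ((fun ν => (((Site.blockSite z r) ν).val : ℤ)) + (t : ℤ) • e μ + e μ))‖ ^ 2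
      = (P.L : ℝ) * ∑ x : Site P l, ‖D (fun ν => ((x ν).val : ℤ)) - conjR (V (fun ν => ((x ν).val : ℤ)) μ) (D ((fun ν => ((x ν).val : ℤ)) + e μ))‖ ^ 2 := by
    rw [Finset.sum_congr rfl fun z _ => Finset.sum_comm, Finset.sum_comm]
    rw [Finset.sum_congr rfl fun (t : ℕ) _ => htile _ hnDper ((t : ℤ) • e μ), Finset.sum_const, Finset.card_range, nsmul_eq_mul]
  have hAsum : ∀ κ : Fin P.d, ∑ z : Site P (l + 1), ∑ s : Fin P.d → Fin P.L, ∑ t ∈ Finset.range P.L,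
        ‖Y ((fun ν => (((Site.blockSite z s) ν).val : ℤ)) + (t : ℤ) • e μ) κ
          - conjR (V ((fun ν => (((Site.blockSite z s) ν).val : ℤ)) + (t : ℤ) • e μ) μ) (Y ((fun ν => (((Site.blockSite z s) ν).val : ℤ)) + (t : ℤ) • e μ + e μ) κ)‖ ^ 2
      = (P.L : ℝ) * ∑ x : Site P l, ‖Y (fun ν => ((x ν).val : ℤ)) κ - conjR (V (fun ν => ((x ν).val : ℤ)) μ) (Y ((fun ν => ((x ν).val : ℤ)) + e μ) κ)‖ ^ 2 := by
    intro κ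
    rw [Finset.sum_congr rfl fun z _ => Finset.sum_comm, Finset.sum_comm]
    rw [Finset.sum_congr rfl fun (t : ℕ) _ => htile _ (hnYper κ) ((t : ℤ) • e μ), Finset.sum_const, Finset.card_range, nsmul_eq_mul]
  have hBsum : ∀ κ : Fin P.d, ∑ z : Site P (l + 1), ∑ s : Fin P.d → Fin P.L, ‖Y ((fun ν => (((Site.blockSite z s) ν).val : ℤ)) + (P.L : ℤ) • e μ) κ‖ ^ 2
      = ∑ x : Site P l, ‖Y (fun ν => ((x ν).val : ℤ)) κ‖ ^ 2 := fun κ => htile _ (hYnper κ) _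
  have hDsum : ∑ z : Site P (l + 1), ∑ r : Fin P.d → Fin P.L, ‖D ((fun ν => (((Site.blockSite z r) ν).val : ℤ)) + (P.L : ℤ) • e μ)‖ ^ 2
      = ∑ x : Site P l, ‖D (fun ν => ((x ν).val : ℤ))‖ ^ 2 := htile _ hDnper _
  -- the two source sums with the `κ`-sum pulled out
  have hAsum' : ∑ z : Site P (l + 1), ∑ s : Fin P.d → Fin P.L, ∑ κ : Fin P.d, ∑ t ∈ Finset.range P.L,
        ‖Y ((fun ν => (((Site.blockSite z s) ν).val : ℤ)) + (t : ℤ) • e μ) κ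
          - conjR (V ((fun ν => (((Site.blockSite z s) ν).val : ℤ)) + (t : ℤ) • e μ) μ) (Y ((fun ν => (((Site.blockSite z s) ν).val : ℤ)) + (t : ℤ) • e μ + e μ) κ)‖ ^ 2
      = (P.L : ℝ) * ∑ x : Site P l, ∑ κ : Fin P.d, ‖Y (fun ν => ((x ν).val : ℤ)) κ - conjR (V (fun ν => ((x ν).val : ℤ)) μ) (Y ((fun ν => ((x ν).val : ℤ)) + e μ) κ)‖ ^ 2 := by
    rw [Finset.sum_congr rfl fun z _ => Finset.sum_comm, Finset.sum_comm, Finset.sum_congr rfl fun κ _ => hAsum κ, ← Finset.mul_sum, Finset.sum_comm]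
  have hBsum' : ∑ z : Site P (l + 1), ∑ s : Fin P.d → Fin P.L, ∑ κ : Fin P.d, ‖Y ((fun ν => (((Site.blockSite z s) ν).val : ℤ)) + (P.L : ℤ) • e μ) κ‖ ^ 2
      = ∑ x : Site P l, ∑ κ : Fin P.d, ‖Y (fun ν => ((x ν).val : ℤ)) κ‖ ^ 2 := by
    rw [Finset.sum_congr rfl fun z _ => Finset.sum_comm, Finset.sum_comm, Finset.sum_congr rfl fun κ _ => hBsum κ, Finset.sum_comm]
  -- (4) assemble: per-(z,r) bound, then the sums
  have hzr : ∀ (z : Site P (l + 1)) (r : Fin P.d → Fin P.L),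
      4 * ( asum (fun y κ => ∑ t ∈ Finset.range P.L, ‖Y (y + (t : ℤ) • e μ) κ - conjR (V (y + (t : ℤ) • e μ) μ) (Y (y + ((t : ℤ) + 1) • e μ) κ)‖)
              ((P.L : ℤ) • (fun ν => ((z ν).val : ℤ))) (treeWord (boxVec P.L r)) ^ 2
            + (2 * (((treeWord (boxVec P.L r)).length : ℝ) * δ + δ₀) * asum (fun y κ => ‖Y y κ‖) ((P.L : ℤ) • (fun ν => ((z ν).val : ℤ)) + (P.L : ℤ) • e μ) (treeWord (boxVec P.L r))) ^ 2
            + (∑ t ∈ Finset.range P.L, ‖D ((P.L : ℤ) • (fun ν => ((z ν).val : ℤ)) + boxVec P.L r + (t : ℤ) • e μ)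
                - conjR (V ((P.L : ℤ) • (fun ν => ((z ν).val : ℤ)) + boxVec P.L r + (t : ℤ) • e μ) μ) (D ((P.L : ℤ) • (fun ν => ((z ν).val : ℤ)) + boxVec P.L r + ((t : ℤ) + 1) • e μ))‖) ^ 2
            + (2 * δ₁ * ‖D ((P.L : ℤ) • (fun ν => ((z ν).val : ℤ)) + (P.L : ℤ) • e μ + boxVec P.L r)‖) ^ 2 )
        ≤ 4 * ( ((P.d * P.L : ℕ) : ℝ) ^ 2 * ((P.L : ℝ) * ∑ s : Fin P.d → Fin P.L, ∑ κ : Fin P.d, ∑ t ∈ Finset.range P.L,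
            ‖Y ((fun ν => (((Site.blockSite z s) ν).val : ℤ)) + (t : ℤ) • e μ) κ
              - conjR (V ((fun ν => (((Site.blockSite z s) ν).val : ℤ)) + (t : ℤ) • e μ) μ) (Y ((fun ν => (((Site.blockSite z s) ν).val : ℤ)) + (t : ℤ) • e μ + e μ) κ)‖ ^ 2)
          + 4 * (((P.d * P.L : ℕ) : ℝ) * δ + δ₀) ^ 2 * (((P.d * P.L : ℕ) : ℝ) ^ 2
            * ∑ s : Fin P.d → Fin P.L, ∑ κ : Fin P.d, ‖Y ((fun ν => (((Site.blockSite z s) ν).val : ℤ)) + (P.L : ℤ) • e μ) κ‖ ^ 2)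
          + (P.L : ℝ) * ∑ t ∈ Finset.range P.L, ‖D ((fun ν => (((Site.blockSite z r) ν).val : ℤ)) + (t : ℤ) • e μ)
            - conjR (V ((fun ν => (((Site.blockSite z r) ν).val : ℤ)) + (t : ℤ) • e μ) μ) (D ((fun ν => (((Site.blockSite z r) ν).val : ℤ)) + (t : ℤ) • e μ + e μ))‖ ^ 2
          + 4 * δ₁ ^ 2 * ‖D ((fun ν => (((Site.blockSite z r) ν).val : ℤ)) + (P.L : ℤ) • e μ)‖ ^ 2 ) := by
    intro z r
    have := hA2 z r; have := hB2 z r; have := hC2 z r; have := hD2 z r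
    linarith
  calc ∑ z : Site P (l + 1), ‖D' (fun ν => ((z ν).val : ℤ)) - conjR (T (fun ν => ((z ν).val : ℤ)) μ) (D' ((fun ν => ((z ν).val : ℤ)) + e μ))‖ ^ 2
      ≤ ∑ z : Site P (l + 1), ((P.L : ℝ) ^ P.d)⁻¹ * ∑ r : Fin P.d → Fin P.L, 4 *
          ( ((P.d * P.L : ℕ) : ℝ) ^ 2 * ((P.L : ℝ) * ∑ s : Fin P.d → Fin P.L, ∑ κ : Fin P.d, ∑ t ∈ Finset.range P.L,
            ‖Y ((fun ν => (((Site.blockSite z s) ν).val : ℤ)) + (t : ℤ) • e μ) κ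
              - conjR (V ((fun ν => (((Site.blockSite z s) ν).val : ℤ)) + (t : ℤ) • e μ) μ) (Y ((fun ν => (((Site.blockSite z s) ν).val : ℤ)) + (t : ℤ) • e μ + e μ) κ)‖ ^ 2)
          + 4 * (((P.d * P.L : ℕ) : ℝ) * δ + δ₀) ^ 2 * (((P.d * P.L : ℕ) : ℝ) ^ 2
            * ∑ s : Fin P.d → Fin P.L, ∑ κ : Fin P.d, ‖Y ((fun ν => (((Site.blockSite z s) ν).val : ℤ)) + (P.L : ℤ) • e μ) κ‖ ^ 2)
          + (P.L : ℝ) * ∑ t ∈ Finset.range P.L, ‖D ((fun ν => (((Site.blockSite z r) ν).val : ℤ)) + (t : ℤ) • e μ)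
            - conjR (V ((fun ν => (((Site.blockSite z r) ν).val : ℤ)) + (t : ℤ) • e μ) μ) (D ((fun ν => (((Site.blockSite z r) ν).val : ℤ)) + (t : ℤ) • e μ + e μ))‖ ^ 2
          + 4 * δ₁ ^ 2 * ‖D ((fun ν => (((Site.blockSite z r) ν).val : ℤ)) + (P.L : ℤ) • e μ)‖ ^ 2 ) := by
        refine Finset.sum_le_sum fun z _ => (hpt z).trans ?_
        exact mul_le_mul_of_nonneg_left (Finset.sum_le_sum fun r _ => hzr z r) (by positivity)
    _ = 4 * ((P.L : ℝ) ^ 2 * ((P.L : ℝ) ^ P.d)⁻¹) * ∑ x : Site P l, ‖D (fun ν => ((x ν).val : ℤ)) - conjR (V (fun ν => ((x ν).val : ℤ)) μ) (D ((fun ν => ((x ν).val : ℤ)) + e μ))‖ ^ 2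
        + 16 * ((P.L : ℝ) ^ P.d)⁻¹ * δ₁ ^ 2 * ∑ x : Site P l, ‖D (fun ν => ((x ν).val : ℤ))‖ ^ 2
        + 4 * (P.L : ℝ) ^ 2 * ((P.d * P.L : ℕ) : ℝ) ^ 2
          * ∑ x : Site P l, ∑ κ : Fin P.d, ‖Y (fun ν => ((x ν).val : ℤ)) κ - conjR (V (fun ν => ((x ν).val : ℤ)) μ) (Y ((fun ν => ((x ν).val : ℤ)) + e μ) κ)‖ ^ 2
        + 16 * ((P.d * P.L : ℕ) : ℝ) ^ 2 * (((P.d * P.L : ℕ) : ℝ) * δ + δ₀) ^ 2 * ∑ x : Site P l, ∑ κ : Fin P.d, ‖Y (fun ν => ((x ν).val : ℤ)) κ‖ ^ 2 := by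
        -- split the `r`-sum into the four families, evaluate the `r`-independent ones (`card = Lᵈ`), re-index
        have hsplit : ∀ z : Site P (l + 1), ((P.L : ℝ) ^ P.d)⁻¹ * ∑ r : Fin P.d → Fin P.L, 4 *
            ( ((P.d * P.L : ℕ) : ℝ) ^ 2 * ((P.L : ℝ) * ∑ s : Fin P.d → Fin P.L, ∑ κ : Fin P.d, ∑ t ∈ Finset.range P.L,
              ‖Y ((fun ν => (((Site.blockSite z s) ν).val : ℤ)) + (t : ℤ) • e μ) κ
                - conjR (V ((fun ν => (((Site.blockSite z s) ν).val : ℤ)) + (t : ℤ) • e μ) μ) (Y ((fun ν => (((Site.blockSite z s) ν).val : ℤ)) + (t : ℤ) • e μ + e μ) κ)‖ ^ 2)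
            + 4 * (((P.d * P.L : ℕ) : ℝ) * δ + δ₀) ^ 2 * (((P.d * P.L : ℕ) : ℝ) ^ 2
              * ∑ s : Fin P.d → Fin P.L, ∑ κ : Fin P.d, ‖Y ((fun ν => (((Site.blockSite z s) ν).val : ℤ)) + (P.L : ℤ) • e μ) κ‖ ^ 2)
            + (P.L : ℝ) * ∑ t ∈ Finset.range P.L, ‖D ((fun ν => (((Site.blockSite z r) ν).val : ℤ)) + (t : ℤ) • e μ)
              - conjR (V ((fun ν => (((Site.blockSite z r) ν).val : ℤ)) + (t : ℤ) • e μ) μ) (D ((fun ν => (((Site.blockSite z r) ν).val : ℤ)) + (t : ℤ) • e μ + e μ))‖ ^ 2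
            + 4 * δ₁ ^ 2 * ‖D ((fun ν => (((Site.blockSite z r) ν).val : ℤ)) + (P.L : ℤ) • e μ)‖ ^ 2 )
            = 4 * ((P.d * P.L : ℕ) : ℝ) ^ 2 * (P.L : ℝ) * ∑ s : Fin P.d → Fin P.L, ∑ κ : Fin P.d, ∑ t ∈ Finset.range P.L,
                ‖Y ((fun ν => (((Site.blockSite z s) ν).val : ℤ)) + (t : ℤ) • e μ) κ
                  - conjR (V ((fun ν => (((Site.blockSite z s) ν).val : ℤ)) + (t : ℤ) • e μ) μ) (Y ((fun ν => (((Site.blockSite z s) ν).val : ℤ)) + (t : ℤ) • e μ + e μ) κ)‖ ^ 2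
              + 16 * (((P.d * P.L : ℕ) : ℝ) * δ + δ₀) ^ 2 * ((P.d * P.L : ℕ) : ℝ) ^ 2
                * ∑ s : Fin P.d → Fin P.L, ∑ κ : Fin P.d, ‖Y ((fun ν => (((Site.blockSite z s) ν).val : ℤ)) + (P.L : ℤ) • e μ) κ‖ ^ 2
              + 4 * ((P.L : ℝ) * ((P.L : ℝ) ^ P.d)⁻¹) * ∑ r : Fin P.d → Fin P.L, ∑ t ∈ Finset.range P.L, ‖D ((fun ν => (((Site.blockSite z r) ν).val : ℤ)) + (t : ℤ) • e μ)
                - conjR (V ((fun ν => (((Site.blockSite z r) ν).val : ℤ)) + (t : ℤ) • e μ) μ) (D ((fun ν => (((Site.blockSite z r) ν).val : ℤ)) + (t : ℤ) • e μ + e μ))‖ ^ 2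
              + 16 * ((P.L : ℝ) ^ P.d)⁻¹ * δ₁ ^ 2 * ∑ r : Fin P.d → Fin P.L, ‖D ((fun ν => (((Site.blockSite z r) ν).val : ℤ)) + (P.L : ℤ) • e μ)‖ ^ 2 := by
          intro z
          rw [Finset.mul_sum]
          simp only [mul_add, Finset.sum_add_distrib, Finset.sum_const, Finset.card_univ, nsmul_eq_mul, ← Finset.mul_sum]
          have hκ : ((Fintype.card (Fin P.d → Fin P.L) : ℕ) : ℝ) = (P.L : ℝ) ^ P.d := hcard
          rw [hκ]
          field_simp
          ring
        rw [Finset.sum_congr rfl fun z _ => hsplit z]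
        simp only [Finset.sum_add_distrib, ← Finset.mul_sum]
        rw [hAsum', hBsum', hCsum, hDsum]
        ring

end Step

end Summit.QuantumFields.YangMills.Theorems.Prop7CornerFrameLegsStepCell

end
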